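import Literature.Topology.FourManifolds.TautFoliationsFencePush
import HarnessLib

/-!
# Re-basing a fence at a nearby level

Sibling of `TautFoliationsFences.lean`. A fence `Φ` over a compact parameter space `A` at the
level `τ₀` for the germ family `Γ` is, for every level `τ₁` close to `τ₀`, also a fence at the
level `τ₁` for the **re-based germ family** `Γ₁ a` = the germ at `Φ a τ₁` of the local first
integral of any local datum of the fence at `a`: for `τ₁` close to `τ₀` these germs do not
depend on the datum (the first integrals of two data agree near the base point `Φ a τ₀`, hence
near `Φ a τ₁`; finitely many data suffice by compactness, and a tube argument makes the closeness
uniform), they depend continuously on `a` (locally they form a section of the germ covering),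
and the inverse functions of the data still invert near the new heights. If at a parameter `a₀`
the germ of `Γ` is that of the height of a flow box `e₀` whose vertical is the vertical of the
fence at `a₀`, then so is the germ of `Γ₁` (`germ` clause). This re-basing is what allows to
transport properties of the horizontal of a closed fence at one level to the nearby levels
(the sequel on closed fences in `M`).

* `IsHomeoGermAt.eventually_isHomeoGermAt` (**proved**): being a homeomorphism germ is an open
  condition in the point.
* `IsFenceOn.exists_relevel` (**proved**).

All statements are [folklore].
-/

noncomputable section

open Set Filter Function
open scoped Topology

namespace Literature.Topology.FourManifolds

namespace Foliation

/-- **Being a homeomorphism germ is an open condition in the point.** [folklore] -/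
theorem IsHomeoGermAt.eventually_isHomeoGermAt {φ : ℝ → ℝ} {t : ℝ} (h : IsHomeoGermAt φ t) :
    ∀ᶠ t' in 𝓝 t, IsHomeoGermAt φ t' := by
  obtain ⟨ε, hε, hc, hm⟩ := h
  have hI : Ioo (t - ε / 2) (t + ε / 2) ∈ 𝓝 t := Ioo_mem_nhds (by linarith) (by linarith)
  filter_upwards [hI] with t' ht'
  have hsub : Ioo (t' - ε / 2) (t' + ε / 2) ⊆ Ioo (t - ε) (t + ε) :=
    Ioo_subset_Ioo (by linarith [ht'.1]) (by linarith [ht'.2])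
  exact ⟨ε / 2, by linarith, hc.mono hsub, hm.imp (fun h ↦ h.mono hsub) (fun h ↦ h.mono hsub)⟩

variable {B : Type*} [NormedAddCommGroup B] {M : Type*} [TopologicalSpace M] {F : Foliation B M}
variable {A : Type*} [TopologicalSpace A] [CompactSpace A] [T2Space A]
variable {Γ : C(A, F.GermSpace)} {τ₀ ε : ℝ} {Φ : A → ℝ → M}

omit [T2Space A] in
/-- A tube lemma: a property of `(a, τ)` holding near `(a, τ₀)` for every `a` of a compact
space holds for all `a` for `τ` near `τ₀`. [folklore] -/
theorem eventually_forall_of_forall_mem_nhds {P : A → ℝ → Prop} {τ₀ : ℝ}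
    (h : ∀ a, {x : A × ℝ | P x.1 x.2} ∈ 𝓝 (a, τ₀)) : ∀ᶠ τ in 𝓝 τ₀, ∀ a, P a τ := by
  set S := {x : A × ℝ | P x.1 x.2} with hS
  have hsub : (univ : Set A) ×ˢ ({τ₀} : Set ℝ) ⊆ interior S := by
    rintro ⟨a, τ⟩ ⟨-, hτ⟩
    rw [mem_singleton_iff] at hτ
    subst hτ
    exact mem_interior_iff_mem_nhds.2 (h a)
  obtain ⟨U, V, -, hVo, hU, hV, hUV⟩ := generalized_tube_lemma isCompact_univ isCompact_singleton isOpen_interior hsub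
  filter_upwards [hVo.mem_nhds (hV (mem_singleton τ₀))] with τ hτ a
  exact (show (a, τ) ∈ S from interior_subset (hUV ⟨hU (mem_univ a), hτ⟩))

/-- **Re-basing a fence at a nearby level.** See the module docstring. [folklore] -/
theorem IsFenceOn.exists_relevel [Nonempty B] (hΦ : IsFenceOn F Γ τ₀ ε Φ univ) (hε : 0 < ε) {a₀ : A}
    {e₀ : OpenPartialHomeomorph M (B × ℝ)} (hΓ₀ : (Γ a₀).germ = ↑(height e₀)) :
    ∃ η > (0 : ℝ), η ≤ ε ∧ ∀ τ₁ ∈ Ioo (τ₀ - η) (τ₀ + η), ∃ Γ₁ : C(A, F.GermSpace),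
      (∀ a, (Γ₁ a).pt = toLeafSpace (Φ a τ₁)) ∧ (Γ₁ a₀).germ = ↑(height e₀) ∧
      IsFenceOn F Γ₁ τ₁ (ε - |τ₁ - τ₀|) Φ univ := by
  classical
  have hτ₀ : τ₀ ∈ Ioo (τ₀ - ε) (τ₀ + ε) := ⟨by linarith, by linarith⟩
  -- local data around each point, shrunk to closures of open neighbourhoods
  choose Ua hUa Da hDa using fun a ↦ hΦ.local_level a (mem_univ a)
  have hV : ∀ a, ∃ V : Set A, IsOpen V ∧ a ∈ V ∧ closure V ⊆ Ua a := fun a ↦ by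
    obtain ⟨O, hOU, hOo, haO⟩ := mem_nhds_iff.1 (hUa a)
    obtain ⟨V, hVo, haV, hV⟩ := normal_exists_closure_subset isClosed_singleton hOo (singleton_subset_iff.2 haO)
    exact ⟨V, hVo, haV rfl, hV.trans hOU⟩
  choose Va hVo haV hVU using hV
  obtain ⟨T, hT⟩ := isCompact_univ.elim_finite_subcover Va hVo fun a _ ↦ mem_iUnion.2 ⟨a, haV a⟩
  have hidx : ∀ a, ∃ i ∈ T, a ∈ Va i := fun a ↦ by
    have h := hT (mem_univ a)
    rw [mem_iUnion₂] at h
    obtain ⟨i, hi, h⟩ := h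
    exact ⟨i, hi, h⟩
  choose idx hidxT hidxV using hidx
  set K : A → Set A := fun i ↦ closure (Va i) with hK
  have hKU : ∀ {i a}, a ∈ K i → a ∈ Ua i ∩ univ := fun {i a} ha ↦ ⟨hVU i ha, mem_univ a⟩
  have hVK : ∀ {i a}, a ∈ Va i → a ∈ K i := fun {i a} ha ↦ subset_closure ha
  -- notation for the data
  set bx : A → OpenPartialHomeomorph M (B × ℝ) := fun i ↦ (Da i).box with hbx
  set φ : A → ℝ → ℝ := fun i ↦ (Da i).φ with hφ
  set ψ : A → ℝ → ℝ := fun i ↦ (Da i).ψ with hψ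
  have hbxm : ∀ i, bx i ∈ F.atlas := fun i ↦ (Da i).box_mem
  -- the fence levels in the datum `i` near every point of `K i`
  have hlev : ∀ {i a}, a ∈ K i → ∀ τ ∈ Ioo (τ₀ - ε) (τ₀ + ε), Φ a τ ∈ (bx i).source ∧ height (bx i) (Φ a τ) = ψ i τ :=
    fun {i a} ha τ hτ ↦ hDa i a (hKU ha) τ hτ
  -- (G1) agreement of the first integrals of two data, uniformly for `τ` near `τ₀`
  have hG1 : ∀ᶠ τ in 𝓝 τ₀, ∀ a, ∀ i ∈ T, ∀ j ∈ T, a ∈ K i → a ∈ K j →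
      φ i ∘ height (bx i) =ᶠ[𝓝 (Φ a τ)] φ j ∘ height (bx j) := by
    have key : ∀ i ∈ T, ∀ j ∈ T, ∀ᶠ τ in 𝓝 τ₀, ∀ a, a ∈ K i → a ∈ K j →
        φ i ∘ height (bx i) =ᶠ[𝓝 (Φ a τ)] φ j ∘ height (bx j) := by
      intro i _ j _
      refine eventually_forall_of_forall_mem_nhds (P := fun a τ ↦ a ∈ K i → a ∈ K j →
        φ i ∘ height (bx i) =ᶠ[𝓝 (Φ a τ)] φ j ∘ height (bx j)) fun a ↦ ?_
      by_cases hai : a ∈ K i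
      · by_cases haj : a ∈ K j
        · -- agreement near the base point, transported along the fence
          have h := LocalDatum.eventuallyEq (Da i) (Da j) (a := a) (hKU hai) (hKU haj)
          rw [← hΦ.base a (mem_univ a)] at h
          have h' : ∀ᶠ w in 𝓝 (Φ a τ₀), φ i ∘ height (bx i) =ᶠ[𝓝 w] φ j ∘ height (bx j) := h.eventuallyEq_nhds
          have hc := hΦ.continuousAt isOpen_univ (mem_univ a) hτ₀
          filter_upwards [hc.eventually h'] with x hx _ _
          exact hx
        · have hKo : (K j)ᶜ ∈ 𝓝 a := (isClosed_closure : IsClosed (K j)).isOpen_compl.mem_nhds haj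
          have hcl : ∀ᶠ x : A × ℝ in 𝓝 (a, τ₀), x.1 ∉ K j :=
            (continuousAt_fst (p := (a, τ₀))).preimage_mem_nhds hKo
          filter_upwards [hcl] with x hx _ hxj
          exact absurd hxj hx
      · have hKo : (K i)ᶜ ∈ 𝓝 a := (isClosed_closure : IsClosed (K i)).isOpen_compl.mem_nhds hai
        have hcl : ∀ᶠ x : A × ℝ in 𝓝 (a, τ₀), x.1 ∉ K i :=
          (continuousAt_fst (p := (a, τ₀))).preimage_mem_nhds hKo
        filter_upwards [hcl] with x hx hxi
        exact absurd hxi hx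
    have h := (Filter.eventually_all_finset T).2 fun i hi ↦ (Filter.eventually_all_finset T).2 fun j hj ↦ key i hi j hj
    filter_upwards [h] with τ hτ a i hi j hj hai haj
    exact hτ i hi j hj a hai haj
  -- (G2) validity of the data at the new heights
  have hG2 : ∀ᶠ τ in 𝓝 τ₀, ∀ i ∈ T, IsHomeoGermAt (φ i) (ψ i τ) ∧ ∀ᶠ r in 𝓝 (ψ i τ), ψ i (φ i r) = r := by
    refine (Filter.eventually_all_finset T).2 fun i _ ↦ ?_
    have hψc : ContinuousAt (ψ i) τ₀ := (Da i).ψ_cont.continuousAt (Ioo_mem_nhds hτ₀.1 hτ₀.2)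
    have h1 : ∀ᶠ t in 𝓝 (ψ i τ₀), IsHomeoGermAt (φ i) t :=
      IsHomeoGermAt.eventually_isHomeoGermAt ((Da i).isHomeoGermAt_φ (a := i) (hKU (hVK (haV i))))
    have h2 : ∀ᶠ t in 𝓝 (ψ i τ₀), ∀ᶠ r in 𝓝 t, ψ i (φ i r) = r := eventually_eventually_nhds.2 (Da i).ψ_φ
    filter_upwards [hψc.eventually h1, hψc.eventually h2] with τ h₁ h₂
    exact ⟨h₁, h₂⟩
  -- (G3) at `a₀`: the germ of `Γ` is that of `h_{e₀}`, hence the first integral of its datum is `h_{e₀}` nearby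
  set i₀ := idx a₀ with hi₀
  have hG3 : ∀ᶠ τ in 𝓝 τ₀, (height e₀ : M → ℝ) =ᶠ[𝓝 (Φ a₀ τ)] φ i₀ ∘ height (bx i₀) := by
    have h : (height e₀ : M → ℝ) =ᶠ[𝓝 (ofLeafSpace (Γ a₀).pt)] φ i₀ ∘ height (bx i₀) :=
      Germ.coe_eq.1 (hΓ₀.symm.trans ((Da i₀).germ_eq a₀ (hKU (hVK (hidxV a₀)))))
    rw [← hΦ.base a₀ (mem_univ a₀)] at h
    have hc : ContinuousAt (fun τ ↦ Φ a₀ τ) τ₀ :=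
      (hΦ.continuousAt isOpen_univ (mem_univ a₀) hτ₀).comp (continuousAt_const.prodMk continuousAt_id)
    exact hc.eventually h.eventuallyEq_nhds
  -- the radius `η`
  obtain ⟨η, hη, hηε, hgood⟩ : ∃ η > (0 : ℝ), η ≤ ε ∧ ∀ τ ∈ Ioo (τ₀ - η) (τ₀ + η),
      (∀ a, ∀ i ∈ T, ∀ j ∈ T, a ∈ K i → a ∈ K j → φ i ∘ height (bx i) =ᶠ[𝓝 (Φ a τ)] φ j ∘ height (bx j)) ∧
      (∀ i ∈ T, IsHomeoGermAt (φ i) (ψ i τ) ∧ ∀ᶠ r in 𝓝 (ψ i τ), ψ i (φ i r) = r) ∧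
      ((height e₀ : M → ℝ) =ᶠ[𝓝 (Φ a₀ τ)] φ i₀ ∘ height (bx i₀)) := by
    obtain ⟨η₀, hη₀, h⟩ := Metric.eventually_nhds_iff.1 (hG1.and (hG2.and hG3))
    refine ⟨min η₀ ε, lt_min hη₀ hε, min_le_right _ _, fun τ hτ ↦ h ?_⟩
    rw [Real.dist_eq, abs_lt]
    constructor <;> linarith [hτ.1, hτ.2, min_le_left η₀ ε]
  refine ⟨η, hη, hηε, fun τ₁ hτ₁ ↦ ?_⟩
  obtain ⟨hagree, hvalid, hgerm₀⟩ := hgood τ₁ hτ₁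
  have hτ₁ε : τ₁ ∈ Ioo (τ₀ - ε) (τ₀ + ε) := ⟨by linarith [hτ₁.1], by linarith [hτ₁.2]⟩
  -- the re-based germs
  have hdist : ∀ a, F.IsDistinguishedGerm (Φ a τ₁) ↑(φ (idx a) ∘ height (bx (idx a))) := fun a ↦ by
    have hl := hlev (hVK (hidxV a)) τ₁ hτ₁ε
    refine F.isDistinguishedGerm_comp_height (hbxm _) hl.1 ?_
    rw [show (bx (idx a) (Φ a τ₁)).2 = ψ (idx a) τ₁ from hl.2]
    exact (hvalid _ (hidxT a)).1
  set G₁ : A → F.GermSpace := fun a ↦ ⟨toLeafSpace (Φ a τ₁), ↑(φ (idx a) ∘ height (bx (idx a))), hdist a⟩ with hG₁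
  -- near `a`, the germs can be computed in the datum `idx a`
  have hgerm_loc : ∀ a a', a' ∈ Va (idx a) → (G₁ a').germ = ↑(φ (idx a) ∘ height (bx (idx a))) := fun a a' ha' ↦
    Germ.coe_eq.2 (hagree a' (idx a') (hidxT a') (idx a) (hidxT a) (hVK (hidxV a')) (hVK ha'))
  -- continuity: locally a section of the germ covering
  have hcont : Continuous G₁ := by
    refine continuous_iff_continuousAt.2 fun a ↦ ?_
    set i := idx a with hi
    have hφi : IsHomeoGermAt (φ i) (ψ i τ₁) := (hvalid i (hidxT a)).1
    -- the `B`-coordinate of `Φ a' τ₁` in the box `i`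
    have hb : ContinuousAt (fun a' ↦ (bx i (Φ a' τ₁)).1) a := by
      have hΦc : ContinuousAt (fun a' ↦ Φ a' τ₁) a :=
        ContinuousAt.comp (g := uncurry Φ) (f := fun a' : A ↦ (a', τ₁)) (hΦ.continuousAt isOpen_univ (mem_univ a) hτ₁ε)
          (continuousAt_id.prodMk continuousAt_const)
      exact continuous_fst.continuousAt.comp
        (ContinuousAt.comp (f := fun a' ↦ Φ a' τ₁) (x := a) ((bx i).continuousAt (hlev (hVK (hidxV a)) τ₁ hτ₁ε).1) hΦc)
    have hsec : ContinuousAt (fun a' ↦ F.germSection (hbxm i) (ψ i τ₁) hφi (bx i (Φ a' τ₁)).1) a :=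
      (F.continuous_germSection (hbxm i) (ψ i τ₁) hφi).continuousAt.comp hb
    refine hsec.congr ?_
    filter_upwards [(hVo i).mem_nhds (hidxV a)] with a' ha'
    have hl := hlev (hVK ha') τ₁ hτ₁ε
    have hpt : F.leafPlaqueMap (bx i) (ψ i τ₁) (bx i (Φ a' τ₁)).1 = toLeafSpace (Φ a' τ₁) := by
      apply ofLeafSpace.injective
      rw [ofLeafSpace_leafPlaqueMap]
      exact plaqueMap_fst_eq ⟨hl.1, hl.2⟩
    symm
    refine GermSpace.ext_heq hpt.symm ?_
    show HEq (G₁ a').germ ((↑(φ i ∘ height (bx i)) : Germ (𝓝 (ofLeafSpace (F.leafPlaqueMap (bx i) (ψ i τ₁) (bx i (Φ a' τ₁)).1))) ℝ))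
    rw [hgerm_loc a a' ha']
    exact GermSpace.coe_germ_heq (congrArg ofLeafSpace hpt.symm) _
  set Γ₁ : C(A, F.GermSpace) := ⟨G₁, hcont⟩ with hΓ₁
  refine ⟨Γ₁, fun a ↦ rfl, ?_, ?_⟩
  · -- the germ at `a₀`
    show (G₁ a₀).germ = ↑(height e₀)
    rw [hgerm_loc a₀ a₀ (hidxV a₀)]
    exact Germ.coe_eq.2 hgerm₀.symm
  · -- the fence at the new level
    have hI : Ioo (τ₁ - (ε - |τ₁ - τ₀|)) (τ₁ + (ε - |τ₁ - τ₀|)) ⊆ Ioo (τ₀ - ε) (τ₀ + ε) := by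
      intro τ hτ
      rcases le_or_gt 0 (τ₁ - τ₀) with h0 | h0
      · rw [abs_of_nonneg h0] at hτ
        constructor <;> linarith [hτ.1, hτ.2]
      · rw [abs_of_neg h0] at hτ
        constructor <;> linarith [hτ.1, hτ.2]
    refine ⟨hΦ.cont.mono (prod_mono subset_rfl hI), fun a _ ↦ rfl, fun a _ ↦ ?_⟩
    set i := idx a with hi
    have hφi : IsHomeoGermAt (φ i) (ψ i τ₁) := (hvalid i (hidxT a)).1
    refine ⟨Va i, (hVo i).mem_nhds (hidxV a),
      { box := bx i
        box_mem := hbxm i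
        φ := φ i
        ψ := ψ i
        germ_eq := fun a' ha' ↦ hgerm_loc a a' ha'.1
        pt_mem := fun a' ha' ↦ ?_
        φ_ψ := fun τ hτ ↦ (Da i).φ_ψ τ (hI hτ)
        ψ_φ := (hvalid i (hidxT a)).2
        ψ_cont := (Da i).ψ_cont.mono hI
        ψ_inj := (Da i).ψ_inj.mono hI }, fun a' ha' τ hτ ↦ hlev (hVK ha'.1) τ (hI hτ)⟩
    show Φ a' τ₁ ∈ plaque (bx i) (ψ i τ₁)
    exact hlev (hVK ha'.1) τ₁ hτ₁ε

end Foliation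

end Literature.Topology.FourManifolds
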